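import Summits.BirchSwinnertonDyer.BirchSwinnertonDyer.Theses.DerivedKatoValuationDoor
import Literature.NumberTheory.EllipticCurves.Kato2004.FineSelmerDualDescentLengthProofs
import Literature.NumberTheory.EllipticCurves.Kato2004.FineSelmerDualDescentLengthConverseProofs
import Literature.NumberTheory.EllipticCurves.Kato2004.IwasawaCohomology
import Literature.NumberTheory.EllipticCurves.NonEisensteinPrimeOfSurjective
import Summits.BirchSwinnertonDyer.BirchSwinnertonDyer.Theorems.DerivedKatoValuationDoorFineLengthLeOneOfAnalyticRankTwoStubOneLeRankIwasawaH1
import Literature.NumberTheory.EllipticCurves.Kato2004.IwasawaH1RankLowerBound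
import Literature.NumberTheory.EllipticCurves.PAdicLFunction
import HarnessLib

/-!
# Crux `FineLengthLeOneOfAnalyticRankTwo` (stmt-BirchSwinnertonDyer-23259) — line `descent`
# (`Cruxes/FineLengthLeOneOfAnalyticRankTwo/Lines/descent.lean`, revision 5)

Route `DerivedKatoValuationDoor` (route-BirchSwinnertonDyer-DerivedKatoValuationDoor), child crux of
`DerivedKatoDoor` (split gen 1, glue `derivedKatoDoor_of_parts`): for every `E/ℚ` (global minimal
model `W`) of analytic rank `2`, every DOOR PRIME `p` (`5 ≤ p`, good ordinary, `ρ̄_{E,p}` onto),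
every cyclotomic `ℤ_p`-extension datum `K` and topological generator `γ`,
`ℓ_T(X₀(E/ℚ_∞)) ≤ 1`, where `X₀ = (W.fineSelmerDualData K hγ).X` is the CONSTRUCTED Pontryagin dual
of the fine Selmer group `Sel₀(ℚ_∞, E[p^∞])` and `ℓ_T = Module.lengthAt Λ · (T)` is the length at the
height-one prime `(T)` of `Λ = ℤ_p⟦T⟧`. The crux is FIXED (decl
`Summit.BirchSwinnertonDyer.BirchSwinnertonDyer.Theses.DerivedKatoValuationDoor.FineLengthLeOneOfAnalyticRankTwo`).
BSD is not proved by any of this.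

PROVENANCE. Filed by the LEAD prover-bsd-line-dkd-p1-g1-0 (2026-08-28) on director-bsd (273)/(280)(f):
the parent's picked line `Cruxes/DerivedKatoDoor/Lines/lower.lean` r6 is CLOSED modulo exactly this
child and the print fact `kato_mainConjecture_primeT_of_door` (item 23260); this file re-points the
line one level down — it decomposes the child itself. Revision 2 (same session) RESHAPES the two print
stubs of revision 1 (878668ca8a68) to strictly WEAKER named facts: F1 `kato_mainConjecture_primeT_of_door`
(BCS IMC + Kato §17.13 + (14.9.1) + Imai) ↦ `exists_iwasawaH2Data_fineSelmerDual_embedding` (Kato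
(14.9.1)/(17.13.1) ALONE, a construction fact; Imai's finiteness is DISCHARGED by the tree theorem
`WeierstrassCurve.finite_fixedPoints_kerSubgroup_inf_decomp_of_ordinary`), and F2 `thm12_4` (Thm. 12.4
(2)(3), `𝐇¹` free of rank one) ↦ `one_le_rank_iwasawaH1` ((12.2.2): `𝐇¹ ≠ 0`; finite generation and
torsion-freeness of `𝐇¹` are tree THEOREMS). NO main conjecture, NO Thm. 12.4 (3) in the line any more.
Revision 3: the sorry-free descent count LANDED in the tree (p668725,
`Literature/NumberTheory/EllipticCurves/Kato2004/FineSelmerDualDescentLengthProofs.lean`: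
`WeierstrassCurve.fineSelmerDual_lengthAt_le_one_of_TSubmodule_of_rank_le_two` and the (14.14.1)
lemmas); this file now IMPORTS it, so everything outside the four `stub_*` is a tree theorem.
Revision 4: the CONVERSE count landed too (p669472, `…/FineSelmerDualDescentLengthConverseProofs.lean`:
`WeierstrassCurve.rank_integralH1_le_two_of_fineSelmerDual_lengthAt_le_one`, `ℓ_T(X₀) ≤ 1 ⇒ rank ≤ 2` modulo
(14.9.1) + `thm12_4`); §5 records both necessity certificates: S1 ∧ S2 ≡ crux modulo print, kernel-typed.
Revision 5 (RESHAPE of F2, integrating seat w2's landed helper p670012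
`Theorems/DerivedKatoValuationDoorFineLengthLeOneOfAnalyticRankTwoStubOneLeRankIwasawaH1.lean`): w2 proved that
at a DOOR PRIME `𝐇¹_Γ(T_pW) ≠ 0` for EVERY cyclotomic pin follows from the route's OWN support item
`AdmissibleZetaClassExists` (stmt-BirchSwinnertonDyer-23029, a binder of `closes`) — the admissible class is
`≠ 0` (landed `stub_admissibleNeZero`) and non-triviality transports across pins/data
(`nontrivial_iwasawaH1_of_nontrivial`). So F2 is now the route decl `AdmissibleZetaClassExists` BY NAME
(`stub_admissibleZetaClassExists`), and the Literature fact (12.2.2) leaves the line: the child crux is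
CLOSED MODULO {S1, S2} ∪ {F1 = (14.9.1) embedding ⊆ item 23260's fact, F2 = item 23029} — modulo print the
route ALREADY owes, nothing else.

## Line `descent` — read `ℓ_T(X₀)` through Kato's descent sequence (14.14.1), not through a
fine-Selmer control theorem

Write `𝐇¹ = I.H` (the pinned `IwasawaH1Data`, which EXISTS for every datum: tree theorem
`nonempty_iwasawaH1Data_holds`; finitely generated: `IwasawaH1Data.module_finite_of_isCyclotomic`;
torsion free: `IwasawaH1Data.isTorsionFree` — all PROVED), `𝐇² = J.H2` and `A = J.A = H¹(ℤ[1/p], T_pW)`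
for Kato's descent package `J : IwasawaH2Data W p K γ I` (tree structure; (14.14.1)
`0 → 𝐇¹/T𝐇¹ →ι A →π 𝐇²[T] → 0` is a FIELD, with `A` pinned to `integralH1 (tateRep W p) p (K.layerSubgroup 0)`
and `T` acting as `0` on `A`), `M[T] = invariants p M`, `TM = TSubmodule p M`, `M/TM = coinvariants p M`.
Then, in `ℕ∞`:

  `ℓ_T(X₀) = ℓ_T(X₀[T]) + ℓ_T(T·X₀)`            (tree: `lengthAt_eq_invariants_add_TSubmodule`)
  `ℓ_T(T·X₀) = 0`                                 (STUB S1, OPEN: `T`-semisimplicity of `X₀`)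
  `ℓ_T(X₀[T]) ≤ ℓ_T(𝐇²[T])`                       (PROVED here from `X₀ ↪ 𝐇²`: stub F1 + Imai, a tree theorem)
  `ℓ_T(𝐇²[T]) + ℓ_T(𝐇¹/T𝐇¹) = ℓ_T(A)`             (PROVED here from (14.14.1))
  `1 ≤ ℓ_T(𝐇¹/T𝐇¹)`                              (w2's p670012 from stub F2 = item 23029: `𝐇¹ ≠ 0` at a door prime)
  `ℓ_T(A) = rank_{ℤ_p} A ≤ rank_{ℤ_p} H¹(ℤ[1/p], T_pW) ≤ 2`   (PROVED here from the pin; STUB S2, OPEN)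

so `ℓ_T(X₀) ≤ 1`. No `p`-adic `L`-function, no main conjecture, no Coleman map, no `p`-adic height, no
zeta element, NO CONTROL THEOREM: the bottom layer enters only through Kato's `H¹(ℤ[1/p], T_pW)`, an
object the tree HAS (`integralH1`), which is why — unlike the parent's r6 plan («the bottom-layer
fine-Selmer corank has no decl in the tree») — the open content can now be typed as TWO separate
named statements.

STUBS (registered; `sorry` only in the four `stub_*`):
* S1 `stub_fineTSemisimpleOfAnalyticRankTwo` — OPEN. `a = 2`, door `⇒ ℓ_T(T·X₀) = 0`: the localisation
  `X₀_(T)` is killed by `T`, i.e. the `T`-primary part of `X₀(E/ℚ_∞)` is SEMISIMPLE (every `T`-Jordan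
  block is `Λ/T`). This is Greenberg's semisimplicity problem for the FINE Selmer dual at `T`
  (Kurihara–Pollack [KP07, Problem 0.7, p. 352: `char X₀(E/ℚ_∞) = (∏_{e_n ≥ 1} Φ_n^{e_n−1})`, whose
  `(T)`-part at `r = 2` reads `ℓ_T(X₀) = 1`; §3.1 Problem 3.2]; Lim [Lim22, Conj. 4.2] «very little
  evidence in literature»; Greenberg [Gr99, p. 65]); by Perrin-Riou's dictionary it is the
  non-degeneracy of the fine `p`-adic height / fine regulator `Reg₀ ≠ 0` [PR93, Conj. 3.3.7 (i)] =
  [SW13, Conj. 4.4] (critic ADDENDUM #22a). In the tree's `IwasawaEulerCharProofs` vocabulary S1 ⟺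
  `ℓ_T(ker φ_{X₀}) = 0` (`lengthAt_TSubmodule_eq_zero_iff`, for `X₀` f.g. torsion).
* S2 `stub_integralH1RankLeTwoOfAnalyticRankTwo` — OPEN. `a = 2`, door `⇒ rank_{ℤ_p} H¹(ℤ[1/p], T_pW) ≤ 2`
  (`Module.rank ℤ_[p] ↥(integralH1 (tateRep W p) p ⊤) ≤ 2`; the module is finitely generated by the tree
  theorem `module_finite_integralH1_top`, so nothing is junk). PRINT DICTIONARY (Poitou–Tate / global
  Euler characteristic for `V = V_pE`, `H⁰ = 0`, `H¹(ℚ_ℓ, V) = 0` for `ℓ ≠ p`):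
  `rank H¹(ℤ[1/p], T_pW) = 1 + s`, `s := rank H²(ℤ[1/p], T_pW) = rank` of the STRICT part (integral
  classes with `loc_p = 0`) `= s_p − ε_p` [BKS19, proof of Prop. 4.5; KP07 Lemma 1.4 = PR93 Lemme 2.3.9:
  the image of `loc_p` is ONE line]. So S2 ⟺ `s ≤ 1` ⟺ (strict pair dependence, the CONCLUSION shape
  of the route's support P1 `StrictRankLeDerivedOrder`) ⟺ (given `s_p ≥ 2` at `a = 2`, tree theorems
  modulo BCS + parity) `s_p = 2 ∧ ε_p = 1` = `SelCapTwoAt ∧ CrisAt` of the parent's docstring. Why it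
  might fail while BSD survives: only on the phantom cell `a = 2 ∧ r = 0` (`ε_p = 0`, `Ш[p^∞]` of corank
  `2`); with two rational points it is `s_p ≤ 2`, i.e. `Ш(E)[p^∞]` finite ∧ `r ≤ 2` — BSD-strength.
  NOTE FOR THE PLANNER: S2 at `(W, p)` is exactly what `closes` consumes downstream (`hstr`, via P1);
  the door `DerivedKatoDoor` ⟹ S2 (BKS Prop. 4.5) and S1 ∧ S2 ⟹ this crux ⟹ door (this file + glue):
  modulo print the door EXCEEDS its use in `closes` by exactly S1.
* F1 `stub_fineSelmerDualEmbedding` — PRINT NAMED FACT verbatim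
  `Kato2004.exists_iwasawaH2Data_fineSelmerDual_embedding` (Kato (14.9.1) (p. 239) / (17.13.1): for `p`
  odd, `κ` cyclotomic and `E(ℚ_{p,∞})[p^∞]` finite, Kato's `𝐇²_Γ(T_pW)` as a descent package `J` over
  every pin `I`, WITH the Poitou–Tate embedding `X₀(E/ℚ_∞) ↪ J.H2` of finite cokernel). A CONSTRUCTION
  fact; weaker than (and upstream of) item 23260's `kato_mainConjecture_primeT_of_door`. Its finiteness
  hypothesis is discharged at a door prime by the tree theorem
  `WeierstrassCurve.finite_fixedPoints_kerSubgroup_inf_decomp_of_ordinary` (Imai / Mazur 6.12, PROVED).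
* F2 `stub_admissibleZetaClassExists` — ROUTE ITEM 23029 `AdmissibleZetaClassExists` BY NAME (Kato Thm. 12.5
  realisability at a door prime; a binder of `closes`). Used only as «`𝐇¹_Γ(T_pW) ≠ 0` for every cyclotomic
  pin at a door prime», which seat w2 derived from it (p670012: admissible ⇒ `≠ 0` by the landed
  `stub_admissibleNeZero`; transport across pins/data by `nontrivial_iwasawaH1_of_nontrivial`). Revisions 2–4
  used the Literature fact `one_le_rank_iwasawaH1` ((12.2.2)) here; it is implied at door primes by F2.
* `FineLengthLeOneOfAnalyticRankTwo_of` — COMPOSITION (real proof, the crux BY NAME).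

Honesty notes. (1) OPEN content = S1 ∧ S2; S1 is NECESSARY for the crux given `1 ≤ ℓ_T(X₀[T])`
(certificate `fineTSemisimple_of_fineLengthLeOne_of_invariants_pos`, elementary), and S2 is necessary
modulo `thm12_4` (`ℓ_T(𝐇¹/T𝐇¹) ≤ 1`) and the finite cokernel of F1 — so the line neither loses nor adds
open content relative to the crux modulo print. (2) Junk audit: `X₀` is CONSTRUCTED; `J`, `e` are
existential outputs of F1 and only `e` injective + the (14.14.1) fields are read (S1 is stated on `X₀`,
NOT on the abstract `J.H2`, where a junk `T²`-block could be manufactured); `I` exists by a tree THEOREM;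
S2 speaks about the tree's own `integralH1 … ⊤` (finitely generated, `module_finite_integralH1_top`).
(3) Disproof used: `Cruxes/DerivedKatoDoor/Disproof.lean` r2 §3 (K-ii) = ¬S1-type cell, (K-i) = ¬S2-type
cell (BSD-violating except on the phantom cell). (4) E-S0-1 atlas (j314336/j314427): `A = 2, B = v_T = 1`
on all 21 680 decided cells ⇒ S1 ∧ S2 hold there modulo print. (5) Trust base of the composition beyond
the two open stubs: {(14.9.1) embedding ⊆ item 23260, item 23029} — print the route already owes;
no IMC, no Thm. 12.4 (3).

References: [Kato04] = [cite: Kato2004Asterisque, §12.2 (12.2.2) (p. 220), §14.9 (14.9.1) (p. 239), §14.14 (14.14.1) (p. 243)];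
[BKS19] = [cite: BurnsKuriharaSano2019, Prop. 4.5]; [Gr99] = [cite: GreenbergLNM1716, Conj. 1.12–1.13 (pp. 64–65)];
[KP07] = [cite: KuriharaPollack2007, Problem 0.7 and §3.1]; [Lim22] = [cite: Lim2022OrderVanishing, Conj. 4.2];
[PR93] = [cite: PerrinRiou1993AIF, Conj. 3.3.7 (i) and Lemme 2.3.9]; [Im75] = [cite: Imai1975, Theorem (p. 12)];
[Wa97] = [cite: Washington1997, §13.2].
-/

-- D-0017: single-problem summit, so `Summit.BirchSwinnertonDyer.BirchSwinnertonDyer.…` repeats a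
-- namespace BY DESIGN.
set_option linter.dupNamespace false

noncomputable section

namespace Summit.BirchSwinnertonDyer.BirchSwinnertonDyer.Cruxes.FineLengthLeOneOfAnalyticRankTwo.Descent

open scoped NumberField
open Field IsDedekindDomain
open Literature Literature.NumberTheory.GaloisRepresentations
open Literature.NumberTheory.EllipticCurves Literature.NumberTheory.EllipticCurves.IwasawaAlgebra
open Literature.NumberTheory.EllipticCurves.Kato2004
open Literature.NumberTheory.EllipticCurves.Kato2004.EulerSystemValues
open Summit.BirchSwinnertonDyer.BirchSwinnertonDyer.Theses.DerivedKatoValuationDoor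
  (FineLengthLeOneOfAnalyticRankTwo)

/-! ## §1 Vocabulary (documentation `abbrev`; every stub below is spelled out in full) -/

/-- **`ℓ_T(M)`**: the length at the height-one prime `𝔭_T = (T)` of a `Λ = ℤ_p⟦T⟧`-module `M`.
[cite: Washington1997, §13.2] -/
abbrev lengthAtT (p : ℕ) [Fact p.Prime] (M : Type) [AddCommGroup M] [Module (IwasawaAlgebra p) M] :
    ℕ∞ :=
  Module.lengthAt (IwasawaAlgebra p) M (primeT p)

/-! ## §2 Stubs (registered; `sorry` only here) -/

/-- **Stub S1 — `stub_fineTSemisimpleOfAnalyticRankTwo` (OPEN; the lead's): at a door prime of an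
analytic-rank-two curve the dual fine Selmer group `X₀(E/ℚ_∞)` is `T`-SEMISIMPLE: `ℓ_T(T·X₀) = 0`**
(for every cyclotomic datum `K` and topological generator `γ`; `X₀ = (W.fineSelmerDualData K hγ).X`,
`T·X₀ = TSubmodule p X₀`). Equivalently `X₀_(T)` is killed by `T`; equivalently (f.g. torsion)
`ℓ_T(ker φ_{X₀}) = 0`. Greenberg's semisimplicity at `T` for the FINE dual (the `(T)`-part of
Kurihara–Pollack's Problem 0.7 at `r = 2`); = Perrin-Riou Conj. 3.3.7 (i) (fine regulator `Reg₀ ≠ 0`) by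
the height dictionary. Why it might fail while BSD survives: one `T²`-Jordan block in `X₀(E/ℚ_∞)` at a
door prime of a rank-two curve (no example in print). Size: open problem.
[cite: KuriharaPollack2007, Problem 0.7 (p. 352)] [cite: GreenbergLNM1716, Conj. 1.12–1.13 and p. 65]
[cite: Lim2022OrderVanishing, Conj. 4.2] [cite: PerrinRiou1993AIF, Conj. 3.3.7 (i)] -/
theorem stub_fineTSemisimpleOfAnalyticRankTwo :
    ∀ (W : WeierstrassCurve ℚ) [W.IsElliptic] [W.IsGloballyMinimal] (p : ℕ) [Fact p.Prime]
      [ContinuousSMul ℤ_[p] (W.tateModule p)], W.analyticRank = 2 →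
      (5 ≤ p ∧ Literature.NumberTheory.EllipticCurves.IsOrdinaryAt W p ∧ W.HasSurjectiveModNGaloisRep p) →
      ∀ (K : Literature.NumberTheory.EllipticCurves.ZpExtension ℚ p), K.IsCyclotomic →
        ∀ (γ : Field.absoluteGaloisGroup ℚ) (hγ : K.IsTopGenerator γ),
          Module.lengthAt (Literature.NumberTheory.EllipticCurves.IwasawaAlgebra p)
              ↥(Literature.NumberTheory.EllipticCurves.IwasawaAlgebra.TSubmodule p
                (W.fineSelmerDualData K hγ).X)
              (Literature.NumberTheory.EllipticCurves.IwasawaAlgebra.primeT p) = 0 := by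
  sorry

/-- **Stub S2 — `stub_integralH1RankLeTwoOfAnalyticRankTwo` (OPEN): at a door prime of an
analytic-rank-two curve, `rank_{ℤ_p} H¹(ℤ[1/p], T_pW) ≤ 2`** (`integralH1 (tateRep W p) p ⊤`, Kato
§8.2: the classes of `H¹(ℚ, T_pW)` unramified away from `p`; finitely generated over `ℤ_p` by the tree
theorem `module_finite_integralH1_top`). PRINT: `rank = 1 + s`, `s` = strict rank `= s_p − ε_p`
(Poitou–Tate; the image of `loc_p` is one line), so S2 ⟺ strict pair dependence ⟺ (at `a = 2`)
`s_p = 2 ∧ ε_p = 1`. Why it might fail while BSD survives: the phantom cell `a = 2 ∧ r = 0` (`ε_p = 0`);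
with two rational points it is `Ш(E)[p^∞]` finite ∧ `r ≤ 2`. Size: open problem (BSD-strength at `a = 2`).
[cite: Kato2004Asterisque, §8.2 and Lemma 8.5 (pp. 180–184), §14.14 (p. 243)] [cite: BurnsKuriharaSano2019, Prop. 4.5]
[cite: KuriharaPollack2007, Lemma 1.4] [cite: PerrinRiou1993AIF, Lemme 2.3.9] -/
theorem stub_integralH1RankLeTwoOfAnalyticRankTwo :
    ∀ (W : WeierstrassCurve ℚ) [W.IsElliptic] [W.IsGloballyMinimal] (p : ℕ) [Fact p.Prime]
      [ContinuousSMul ℤ_[p] (W.tateModule p)], W.analyticRank = 2 →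
      (5 ≤ p ∧ Literature.NumberTheory.EllipticCurves.IsOrdinaryAt W p ∧ W.HasSurjectiveModNGaloisRep p) →
      Module.rank ℤ_[p]
          ↥(Literature.NumberTheory.EllipticCurves.Kato2004.integralH1
            (Literature.NumberTheory.EllipticCurves.Kato2004.EulerSystemValues.tateRep W p) p ⊤) ≤ 2 := by
  sorry

/-- **Stub F1 — `stub_fineSelmerDualEmbedding` (PRINT NAMED FACT verbatim
`Kato2004.exists_iwasawaH2Data_fineSelmerDual_embedding`): for `p` odd, `κ` cyclotomic with topological
generator `γ`, `v` the place at `p` and `E(ℚ_{p,∞})[p^∞]` finite, Kato's `𝐇²_Γ(T_pW)` as a descent package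
`J` over every pin `I`, together with the Poitou–Tate embedding `X₀(E/ℚ_∞) ↪ J.H2` of finite cokernel.**
Kato (14.9.1) (p. 239) «exact in the case `p ≠ 2`», passed to the limit by (17.13.1); a CONSTRUCTION fact
(weaker than and upstream of route item 23260's `kato_mainConjecture_primeT_of_door`). Size XL to discharge
(degree-2 corestriction / Poitou–Tate over `Λ`). [cite: Kato2004Asterisque, (14.9.1) (p. 239), (17.13.1) (p. 279), (14.14.1) (p. 243)] -/
theorem stub_fineSelmerDualEmbedding :
    Literature.NumberTheory.EllipticCurves.Kato2004.exists_iwasawaH2Data_fineSelmerDual_embedding := by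
  sorry

/-- **Stub F2 — `stub_admissibleZetaClassExists` (= ROUTE ITEM stmt-BirchSwinnertonDyer-23029
`AdmissibleZetaClassExists` BY NAME; PRINT, Kato Thm. 12.5 (1)+(4) realisability under (12.5.2), a binder of
`closes`): at a door prime of a globally minimal `E/ℚ` an admissible zeta class exists in some pinned `𝐇¹`
over some cyclotomic datum.** Used (through seat w2's landed `one_le_lengthAt_coinvariants_iwasawaH1_of_admissibleZetaClassExists`,
p670012) only as «`1 ≤ ℓ_T(𝐇¹/T𝐇¹)` for every cyclotomic pin at a door prime». Replaces revision 2–4's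
`stub_oneLeRankIwasawaH1` (`Kato2004.one_le_rank_iwasawaH1`, (12.2.2)), which it implies at door primes
(`one_le_rank_iwasawaH1_at_door_of_admissibleZetaClassExists`). Size L (Kato's Euler system + Lemma 13.11).
[cite: Kato2004Asterisque, Thm. 12.5 (1)(4) (pp. 221–222), Lemma 13.11 (2)] -/
theorem stub_admissibleZetaClassExists :
    Summit.BirchSwinnertonDyer.BirchSwinnertonDyer.Theses.DerivedKatoValuationDoor.AdmissibleZetaClassExists := by
  sorry

/-! ## §3 The descent count — LANDED (p668725)

The (14.14.1) count and the cell-level theorem live in the tree: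
`Kato2004.IwasawaH2Data.lengthAt_A_eq_coinvariants_add_invariants` (`ℓ_T(A) = ℓ_T(𝐇¹/T𝐇¹) + ℓ_T(𝐇²[T])`),
`Kato2004.IwasawaH2Data.lengthAt_A_le_toENat_rank_integralH1` (`ℓ_T(A) ≤ rank_{ℤ_p} H¹(ℤ[1/p], T_pW)`),
`Kato2004.IwasawaH1Data.one_le_lengthAt_coinvariants_of_one_le_rank` (`1 ≤ ℓ_T(𝐇¹/T𝐇¹)` from (12.2.2)),
`Kato2004.exists_iwasawaH2Data_fineSelmerDual_embedding_of_goodOrdinary` (embedding, Imai discharged),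
`IwasawaAlgebra.lengthAt_invariants_le_of_injective`, `IwasawaAlgebra.lengthAt_TSubmodule_eq_zero_of_lengthAt_le_one`,
and `WeierstrassCurve.fineSelmerDual_lengthAt_le_one_of_TSubmodule_of_rank_le_two` (S1 ∧ S2 ⇒ `ℓ_T(X₀) ≤ 1`
at an odd good ordinary prime, modulo the two displayed construction facts). -/

/-- **The descent count at a DOOR PRIME** (the landed (14.14.1) lemmas of p668725 composed at a
door prime — `5 ≤ p` gives `p ≠ 2`, `IsOrdinaryAt` is good ordinary reduction — with the per-pin `𝐇¹`-input
supplied from the route item `AdmissibleZetaClassExists` by seat w2's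
`one_le_lengthAt_coinvariants_iwasawaH1_of_admissibleZetaClassExists`; = tree theorem
`WeierstrassCurve.fineSelmerDual_lengthAt_le_one_of_TSubmodule_of_rank_le_two'`, p670560, spelled out).
[cite: Kato2004Asterisque, §14.14 (14.14.1) (p. 243), (14.9.1) (p. 239), Thm. 12.5 (pp. 221–222)] -/
theorem fineLength_le_one_of_semisimple_of_rank_le_two {W : WeierstrassCurve ℚ} [W.IsElliptic]
    [W.IsGloballyMinimal] {p : ℕ} [Fact p.Prime] [ContinuousSMul ℤ_[p] (W.tateModule p)]
    {K : ZpExtension ℚ p} {γ : absoluteGaloisGroup ℚ}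
    (hPT : exists_iwasawaH2Data_fineSelmerDual_embedding)
    (hAdm : Summit.BirchSwinnertonDyer.BirchSwinnertonDyer.Theses.DerivedKatoValuationDoor.AdmissibleZetaClassExists)
    (hdoor : 5 ≤ p ∧ IsOrdinaryAt W p ∧ W.HasSurjectiveModNGaloisRep p) (hK : K.IsCyclotomic)
    (hγ : K.IsTopGenerator γ)
    (hS1 : lengthAtT p ↥(TSubmodule p (W.fineSelmerDualData K hγ).X) = 0)
    (hS2 : Module.rank ℤ_[p] ↥(integralH1 (tateRep W p) p ⊤) ≤ 2) :
    lengthAtT p (W.fineSelmerDualData K hγ).X ≤ 1 := by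
  have hp2 : p ≠ 2 := by have := hdoor.1; omega
  obtain ⟨hgood, hord⟩ := (isOrdinaryAt_iff W p).1 hdoor.2.1
  -- the pinned `𝐇¹` exists (tree theorem) and Kato's `𝐇²` package with `X₀ ↪ 𝐇²` (F1 + Imai, tree)
  obtain ⟨I⟩ := nonempty_iwasawaH1Data_holds W p K γ hK hγ
  obtain ⟨J, e, he, -⟩ :=
    exists_iwasawaH2Data_fineSelmerDual_embedding_of_goodOrdinary hPT hp2 hgood hord hK hγ I
  -- `1 ≤ ℓ_T(𝐇¹/T𝐇¹)` from the route item (seat w2, p670012)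
  have h1 : 1 ≤ lengthAtT p (coinvariants p I.H) :=
    Summit.BirchSwinnertonDyer.BirchSwinnertonDyer.Theorems.DerivedKatoValuationDoor.one_le_lengthAt_coinvariants_iwasawaH1_of_admissibleZetaClassExists
      W p hAdm hdoor hK hγ I
  -- the (14.14.1) count (landed lemmas, p668725)
  have hA := J.lengthAt_A_eq_coinvariants_add_invariants
  have hA2 : lengthAtT p J.A ≤ 2 :=
    J.lengthAt_A_le_toENat_rank_integralH1.trans (Cardinal.toENat_le_ofNat.mpr hS2)
  have hX : lengthAtT p (W.fineSelmerDualData K hγ).X =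
      lengthAtT p ↥(invariants p (W.fineSelmerDualData K hγ).X) := by
    have h := lengthAt_eq_invariants_add_TSubmodule p (W.fineSelmerDualData K hγ).X
    unfold lengthAtT at hS1
    rw [hS1, add_zero] at h
    exact h
  have hXH : lengthAtT p ↥(invariants p (W.fineSelmerDualData K hγ).X) ≤ lengthAtT p ↥(invariants p J.H2) :=
    IwasawaAlgebra.lengthAt_invariants_le_of_injective e he
  have hH2 : lengthAtT p ↥(invariants p J.H2) ≤ 1 := by
    have h12 : (1 : ℕ∞) + lengthAtT p ↥(invariants p J.H2) ≤ 1 + 1 :=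
      calc (1 : ℕ∞) + lengthAtT p ↥(invariants p J.H2)
          ≤ lengthAtT p (coinvariants p I.H) + lengthAtT p ↥(invariants p J.H2) := add_le_add h1 le_rfl
        _ = lengthAtT p J.A := hA.symm
        _ ≤ 2 := hA2
    exact (ENat.add_le_add_iff_left ENat.one_ne_top).mp h12
  rw [hX]
  exact hXH.trans hH2

/-! ## §4 Composition: the crux from the stubs (real proof; `sorry` enters only through the stubs) -/

/-- **Composition (line `descent`) — the skeleton theorem.** The crux `FineLengthLeOneOfAnalyticRankTwo`,
BY NAME: `ℓ_T(X₀) = ℓ_T(X₀[T]) + ℓ_T(T·X₀) = ℓ_T(X₀[T])` (S1) `≤ ℓ_T(𝐇²[T])` (F1: `X₀ ↪ 𝐇²`, Imai from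
the tree) `= ℓ_T(A) − ℓ_T(𝐇¹/T𝐇¹) ≤ ℓ_T(A) − 1` (F2 = item 23029 via w2's transport, with (14.14.1)) `≤ 2 − 1 = 1`
(S2). No `sorry` of its own; its closure reaches `sorryAx` exactly through the four stubs.
[cite: Kato2004Asterisque, §14.14 (14.14.1) (p. 243), (14.9.1) (p. 239), (12.2.2) (p. 220)] [cite: KuriharaPollack2007, Problem 0.7] -/
theorem FineLengthLeOneOfAnalyticRankTwo_of :
    Summit.BirchSwinnertonDyer.BirchSwinnertonDyer.Theses.DerivedKatoValuationDoor.FineLengthLeOneOfAnalyticRankTwo := by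
  intro W _ _ p _ _ ha hdoor K hK γ hγ
  exact fineLength_le_one_of_semisimple_of_rank_le_two stub_fineSelmerDualEmbedding
    stub_admissibleZetaClassExists hdoor hK hγ (stub_fineTSemisimpleOfAnalyticRankTwo W p ha hdoor K hK γ hγ)
    (stub_integralH1RankLeTwoOfAnalyticRankTwo W p ha hdoor)

/-! ## §5 Certificates (sorry-free) -/

/-- **NECESSITY of S1 (the shape the line needs): `ℓ_T(X₀) ≤ 1` together with `1 ≤ ℓ_T(X₀[T])`
forces `ℓ_T(T·X₀) = 0`** (tree lemma `IwasawaAlgebra.lengthAt_TSubmodule_eq_zero_of_lengthAt_le_one`, read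
off `ℓ_T(X) = ℓ_T(X[T]) + ℓ_T(T·X)`). At an `a = 2` door cell `1 ≤ ℓ_T(X₀[T])` is print (one strict class,
from `s_p ≥ 2`), so the crux there implies S1 there: S1 carries NO excess content over the crux modulo
print. [cite: Washington1997, §13.2] -/
theorem fineTSemisimple_of_fineLengthLeOne_of_invariants_pos {p : ℕ} [Fact p.Prime] {X : Type}
    [AddCommGroup X] [Module (IwasawaAlgebra p) X] (hX : lengthAtT p X ≤ 1)
    (hinv : 1 ≤ lengthAtT p ↥(invariants p X)) : lengthAtT p ↥(TSubmodule p X) = 0 :=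
  IwasawaAlgebra.lengthAt_TSubmodule_eq_zero_of_lengthAt_le_one hX hinv

/-- **NECESSITY of S2 at a door cell, modulo print** (tree theorem
`WeierstrassCurve.rank_integralH1_le_two_of_fineSelmerDual_lengthAt_le_one`, door unfolded): the crux's
conclusion `ℓ_T(X₀) ≤ 1` at `(W, p, K, γ)` forces `rank_{ℤ_p} H¹(ℤ[1/p], T_pW) ≤ 2` — S2's conclusion at
`(W, p)` — modulo the displayed facts F1 (`X₀ ↪ 𝐇²` with FINITE cokernel) and `Kato2004.thm12_4` (`𝐇¹` free
of rank one at a door prime: `5 ≤ p` and `ρ̄` onto give `p ≠ 2` and `E[p]` irreducible). With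
`fineTSemisimple_of_fineLengthLeOne_of_invariants_pos` this types «S1 ∧ S2 ≡ crux modulo print»: the line
smuggles no gap and adds no content. [cite: Kato2004Asterisque, §14.14 (14.14.1) (p. 243), Thm. 12.4 (3) (p. 221)] -/
theorem integralH1RankLeTwo_of_fineLengthLeOne {W : WeierstrassCurve ℚ} [W.IsElliptic]
    [W.IsGloballyMinimal] {p : ℕ} [Fact p.Prime] [ContinuousSMul ℤ_[p] (W.tateModule p)]
    {K : ZpExtension ℚ p} {γ : absoluteGaloisGroup ℚ}
    (hPT : exists_iwasawaH2Data_fineSelmerDual_embedding) (h124 : thm12_4)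
    (hdoor : 5 ≤ p ∧ IsOrdinaryAt W p ∧ W.HasSurjectiveModNGaloisRep p) (hK : K.IsCyclotomic)
    (hγ : K.IsTopGenerator γ) (hX : lengthAtT p (W.fineSelmerDualData K hγ).X ≤ 1) :
    Module.rank ℤ_[p] ↥(integralH1 (tateRep W p) p ⊤) ≤ 2 := by
  have hp2 : p ≠ 2 := by have := hdoor.1; omega
  haveI : NeZero (p : ℚ) := ⟨Nat.cast_ne_zero.mpr (Fact.out : p.Prime).ne_zero⟩
  have hirr : W.HasIrreducibleModPGaloisRep p :=
    hasIrreducibleModPGaloisRep_of_hasSurjectiveModNGaloisRep W p hdoor.2.2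
  obtain ⟨hgood, hord⟩ := (isOrdinaryAt_iff W p).1 hdoor.2.1
  exact W.rank_integralH1_le_two_of_fineSelmerDual_lengthAt_le_one hPT h124 hp2 hgood hord hirr hK hγ hX

/-- **Hypothesis form of the line** (sorry-free certificate of what `descent` reduces the crux to): the
two OPEN stubs, the PRINT construction fact (14.9.1) and the route item `AdmissibleZetaClassExists`, as
displayed hypotheses, give the crux BY NAME.
[cite: Kato2004Asterisque, §14.14 (14.14.1) (p. 243), (14.9.1) (p. 239), (12.2.2) (p. 220)] -/
theorem fineLengthLeOneOfAnalyticRankTwo_of_pieces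
    (hS1 : ∀ (W : WeierstrassCurve ℚ) [W.IsElliptic] [W.IsGloballyMinimal] (p : ℕ) [Fact p.Prime]
      [ContinuousSMul ℤ_[p] (W.tateModule p)], W.analyticRank = 2 →
      (5 ≤ p ∧ IsOrdinaryAt W p ∧ W.HasSurjectiveModNGaloisRep p) →
      ∀ (K : ZpExtension ℚ p), K.IsCyclotomic → ∀ (γ : absoluteGaloisGroup ℚ) (hγ : K.IsTopGenerator γ),
        lengthAtT p ↥(TSubmodule p (W.fineSelmerDualData K hγ).X) = 0)
    (hS2 : ∀ (W : WeierstrassCurve ℚ) [W.IsElliptic] [W.IsGloballyMinimal] (p : ℕ) [Fact p.Prime]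
      [ContinuousSMul ℤ_[p] (W.tateModule p)], W.analyticRank = 2 →
      (5 ≤ p ∧ IsOrdinaryAt W p ∧ W.HasSurjectiveModNGaloisRep p) →
      Module.rank ℤ_[p] ↥(integralH1 (tateRep W p) p ⊤) ≤ 2)
    (hF1 : exists_iwasawaH2Data_fineSelmerDual_embedding)
    (hF2 : Summit.BirchSwinnertonDyer.BirchSwinnertonDyer.Theses.DerivedKatoValuationDoor.AdmissibleZetaClassExists) :
    FineLengthLeOneOfAnalyticRankTwo := by
  intro W _ _ p _ _ ha hdoor K hK γ hγ
  exact fineLength_le_one_of_semisimple_of_rank_le_two hF1 hF2 hdoor hK hγ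
    (hS1 W p ha hdoor K hK γ hγ) (hS2 W p ha hdoor)

end Summit.BirchSwinnertonDyer.BirchSwinnertonDyer.Cruxes.FineLengthLeOneOfAnalyticRankTwo.Descent

end
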